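import Mathlib
import Summits.Schanuel.Schanuel.Theorems.SoloInformedExpAutomorphismDoor
import Literature.NumberTheory.LFunctions.ColossallyAbundantChain

/-!
# The automorphism door, II: pairs of logarithms of rational numbers

Soloist seat `solo-Schanuel-informed`, session 9 (atlas §2 E11 / door (F)); continues
`SoloInformedExpAutomorphismDoor` (endomorphisms `σ` of `ℂ` with `σ ∘ exp = exp ∘ σ`,
"`End(ℂ_exp)`").

1. **Partner lemma** (`exists_algebraicIndependent_pair_of_transcendental`): every transcendental
   `y ∈ ℂ` has an algebraically independent partner, namely `π` or `e^π` (matroid augmentation of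
   `{y}` by Nesterenko's independent pair `{π, e^π}`). Hence the shear mechanism needs no explicit
   partner: `algebraicIndependent_of_shear_of_transcendental`.
2. **Logarithm pairs** (`algebraicIndependent_log_log_of_expEnd`): if `q₁, q₂ ∈ ℚ_{>0}` have
   `ℚ`-linearly independent logarithms and some `σ ∈ End(ℂ_exp)` moves `log q₁` or `log q₂`, then
   `log q₁, log q₂` are algebraically independent. Mechanism: normalise `σ` to `ρ ∈ {σ, cσ}` with
   `ρ(2πi) = 2πi`, `ρ(log qᵢ) = log qᵢ + mᵢ·2πi`, `(m₁, m₂) ≠ 0`; then `y = m₁ log q₂ - m₂ log q₁`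
   is FIXED by `ρ`, is the logarithm of the rational `q₂^{m₁} q₁^{-m₂} ≠ 1`, hence transcendental
   (Hermite–Lindemann, here from the tree's Lindemann–Weierstrass), and `ρ` shears `log q₁` along
   `2πi m₁` over the fixed `y`.
3. **Headline** (`schanuel_three_pairs_of_expEnd_moves_log_two`): ONE endomorphism of `ℂ_exp`
   moving `log 2` yields Schanuel's conjecture, in the summit's format, at THREE of the six
   emblematic open pairs of [Waldschmidt2000, §1.4]: `(iπ, log 2)`, `(1, log 2)`, `(log 2, log 3)`.
   Together with part I: the door is shut at `(1, iπ), (1, e)` for all of `End(ℂ_exp)`, and at the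
   remaining pair `(log 2, √2 log 2)` the second coordinate `2^{√2}` is not fixed but multiplied
   by `e^{2πi√2 m}` — a shear-and-twist, not treated here.

References as in part I: [KMO2012] arXiv:1101.4224, doi:10.1017/s1474748012000047 (Thms 1–2);
[AK2025] arXiv:2405.01399, doi:10.2140/mt.2025.4.37 (Thm 1.1, §4 Case 1, §6.4); [Denis1995]
doi:10.4064/aa-69-1-75-89; [Waldschmidt2000] Grundlehren 326, §1.4; linear independence of
`log 2, log 3` from the tree (`Nat.linearIndependent_log_of_prime_ne`, [Lagarias2002, §2]).
-/

noncomputable section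

open Complex IntermediateField
open scoped ComplexConjugate

namespace Summit.Schanuel.Schanuel.Theorems

/-! ### 1. Partners -/

/-- **Partner lemma.** Every transcendental complex number `y` has an algebraically independent
partner `w` (one of `π`, `e^π`): augment the independent set `{y}` inside the algebraic matroid of
`ℂ/ℚ` by Nesterenko's independent pair `{π, e^π}`. [folklore + Nesterenko1996 via the tree] -/
theorem exists_algebraicIndependent_pair_of_transcendental {y : ℂ} (hy : Transcendental ℚ y) :
    ∃ w : ℂ, AlgebraicIndependent ℚ ![w, y] := by
  classical
  have hne : (Real.pi : ℂ) ≠ cexp Real.pi := by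
    intro h
    have h1 : Real.pi = Real.exp Real.pi := by
      have h2 : ((Real.pi : ℝ) : ℂ) = ((Real.exp Real.pi : ℝ) : ℂ) := by
        rw [Complex.ofReal_exp]
        exact h
      exact_mod_cast h2
    have h3 := Real.add_one_lt_exp Real.pi_ne_zero
    linarith
  have hI : (AlgebraicIndependent.matroid ℚ ℂ).Indep (↑({y} : Finset ℂ)) := by
    rw [Finset.coe_singleton, AlgebraicIndependent.matroid_indep_iff]
    exact (algebraicIndependent_singleton_iff (⟨y, Set.mem_singleton y⟩ : ({y} : Set ℂ))).mpr
      (by simpa using hy)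
  have hJ : (AlgebraicIndependent.matroid ℚ ℂ).Indep
      (↑({(Real.pi : ℂ), cexp Real.pi} : Finset ℂ)) := by
    rw [Finset.coe_pair, AlgebraicIndependent.matroid_indep_iff]
    refine Literature.Barriers.Schanuel.algebraicIndependent_pi_cexp_pi.coe_range.mono ?_
    intro w hw
    rcases hw with rfl | rfl
    · exact ⟨0, by simp⟩
    · exact ⟨1, by simp⟩
  have hcard : ({y} : Finset ℂ).card < ({(Real.pi : ℂ), cexp Real.pi} : Finset ℂ).card := by
    rw [Finset.card_singleton, Finset.card_pair hne]
    norm_num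
  obtain ⟨e, -, heI, hind⟩ := hI.augment_finset hJ hcard
  have hey : e ≠ y := by simpa using heI
  rw [Finset.coe_singleton, AlgebraicIndependent.matroid_indep_iff] at hind
  have hinj : Function.Injective ![e, y] := by
    intro i j hij
    fin_cases i <;> fin_cases j
    · rfl
    · exact absurd (by simpa using hij) hey
    · exact absurd (by simpa using hij.symm) hey
    · rfl
  have hsub : Set.range ![e, y] ⊆ insert e ({y} : Set ℂ) := by
    rintro _ ⟨i, rfl⟩
    fin_cases i <;> simp
  have h2 : AlgebraicIndependent ℚ ((↑) : Set.range ![e, y] → ℂ) := hind.mono hsub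
  exact ⟨e, (algebraicIndependent_subtype_range hinj).mp h2⟩

/-- **Shear ⟹ algebraic independence**, partner-free form: if an endomorphism `φ` of `ℂ`
translates `x` by `a ≠ 0` and fixes `a` and a transcendental `y`, then `x, y` are algebraically
independent. [this file] -/
theorem algebraicIndependent_of_shear_of_transcendental (φ : ℂ →+* ℂ) {x y a : ℂ}
    (hx : φ x = x + a) (ha : φ a = a) (hy : φ y = y) (ha0 : a ≠ 0)
    (hyt : Transcendental ℚ y) : AlgebraicIndependent ℚ ![x, y] := by
  obtain ⟨w₀, hw⟩ := exists_algebraicIndependent_pair_of_transcendental hyt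
  exact algebraicIndependent_of_shear φ hx ha hy ha0 hw

/-! ### 2. Logarithms of rational numbers -/

/-- **Hermite–Lindemann for rational arguments** (from the tree's Lindemann–Weierstrass): `log q`
is transcendental for rational `q > 0`, `q ≠ 1`. [Baker1975, Thm 1.4 (via the tree)] -/
theorem transcendental_log_ratCast {q : ℚ} (hq : 0 < q) (hq1 : q ≠ 1) :
    Transcendental ℚ ((Real.log q : ℝ) : ℂ) := by
  intro halg
  have hq' : (0 : ℝ) < q := by exact_mod_cast hq
  have hne : ((Real.log q : ℝ) : ℂ) ≠ 0 := by
    rw [Ne, Complex.ofReal_eq_zero]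
    exact Real.log_ne_zero_of_pos_of_ne_one hq' (by exact_mod_cast hq1)
  have hli : LinearIndependent ℚ ![((Real.log q : ℝ) : ℂ)] := by
    rw [linearIndependent_unique_iff]
    simpa using hne
  have h := Literature.NumberTheory.Transcendental.algebraicIndependent_exp_holds
    ![((Real.log q : ℝ) : ℂ)] (fun i => by simpa using halg) hli
  have ht : Transcendental ℚ (cexp ((Real.log q : ℝ) : ℂ)) := by
    have h2 := (algebraicIndependent_unique_type_iff (R := ℚ)).mp h
    simpa using h2
  apply ht
  rw [← Complex.ofReal_exp, Real.exp_log hq', Complex.ofReal_ratCast]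
  have h3 := isAlgebraic_algebraMap (R := ℚ) (A := ℂ) q
  rwa [eq_ratCast] at h3

/-- `e^{log q} = q` for a positive rational `q`. [folklore] -/
private theorem exp_log_ratCast {q : ℚ} (hq : 0 < q) : Real.exp (Real.log q) = q :=
  Real.exp_log (by exact_mod_cast hq)

/-- **Theorem O (ii-c): logarithm pairs.** Let `q₁, q₂ > 0` be rationals with `ℚ`-linearly
independent logarithms. If an endomorphism of `ℂ_exp` moves `log q₁` or `log q₂`, then
`log q₁, log q₂` are algebraically independent. [this file] -/
theorem algebraicIndependent_log_log_of_expEnd (σ : ℂ →+* ℂ)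
    (hσ : ∀ z, σ (cexp z) = cexp (σ z)) {q₁ q₂ : ℚ} (hq₁ : 0 < q₁) (hq₂ : 0 < q₂)
    (hli : LinearIndependent ℚ ![((Real.log q₁ : ℝ) : ℂ), ((Real.log q₂ : ℝ) : ℂ)])
    (hmove : σ ((Real.log q₁ : ℝ) : ℂ) ≠ ((Real.log q₁ : ℝ) : ℂ) ∨
      σ ((Real.log q₂ : ℝ) : ℂ) ≠ ((Real.log q₂ : ℝ) : ℂ)) :
    AlgebraicIndependent ℚ ![((Real.log q₁ : ℝ) : ℂ), ((Real.log q₂ : ℝ) : ℂ)] := by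
  have hτ0 : (2 * Real.pi * I : ℂ) ≠ 0 := by simp [Real.pi_ne_zero, I_ne_zero]
  obtain ⟨n₁, hn₁⟩ := expEnd_apply_log σ hσ (exp_log_ratCast hq₁)
  obtain ⟨n₂, hn₂⟩ := expEnd_apply_log σ hσ (exp_log_ratCast hq₂)
  have hn : n₁ ≠ 0 ∨ n₂ ≠ 0 := by
    rcases hmove with h | h
    · left
      rintro rfl
      apply h
      simpa using hn₁
    · right
      rintro rfl
      apply h
      simpa using hn₂
  -- Step 1: normalise to `ρ ∈ {σ, cσ}` fixing `2πi`.
  obtain ⟨ρ, m₁, m₂, hρτ, hρ₁, hρ₂, hm⟩ : ∃ (ρ : ℂ →+* ℂ) (m₁ m₂ : ℤ),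
      ρ (2 * Real.pi * I) = 2 * Real.pi * I ∧
      ρ ((Real.log q₁ : ℝ) : ℂ) = ((Real.log q₁ : ℝ) : ℂ) + m₁ * (2 * Real.pi * I) ∧
      ρ ((Real.log q₂ : ℝ) : ℂ) = ((Real.log q₂ : ℝ) : ℂ) + m₂ * (2 * Real.pi * I) ∧
      (m₁ ≠ 0 ∨ m₂ ≠ 0) := by
    rcases expEnd_apply_two_pi_I σ hσ with hστ | hστ
    · exact ⟨σ, n₁, n₂, hστ, hn₁, hn₂, hn⟩
    · refine ⟨(starRingEnd ℂ).comp σ, -n₁, -n₂, ?_, ?_, ?_, by simpa using hn⟩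
      · rw [RingHom.comp_apply, hστ, map_neg]
        simp [map_mul, map_ofNat, Complex.conj_ofReal, Complex.conj_I]
      · simp only [RingHom.comp_apply, hn₁, map_add, map_mul, map_intCast, map_ofNat,
          Complex.conj_ofReal, Complex.conj_I]
        push_cast
        ring
      · simp only [RingHom.comp_apply, hn₂, map_add, map_mul, map_intCast, map_ofNat,
          Complex.conj_ofReal, Complex.conj_I]
        push_cast
        ring
  -- membership of the two logarithms in `ℚ(log q₁, log q₂)`
  have hmem₁ : ((Real.log q₁ : ℝ) : ℂ) ∈
      adjoin ℚ (Set.range ![((Real.log q₁ : ℝ) : ℂ), ((Real.log q₂ : ℝ) : ℂ)]) :=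
    subset_adjoin ℚ _ ⟨0, by simp⟩
  have hmem₂ : ((Real.log q₂ : ℝ) : ℂ) ∈
      adjoin ℚ (Set.range ![((Real.log q₁ : ℝ) : ℂ), ((Real.log q₂ : ℝ) : ℂ)]) :=
    subset_adjoin ℚ _ ⟨1, by simp⟩
  -- `log q₁` is transcendental (`q₁ ≠ 1` by linear independence)
  have hq₁1 : q₁ ≠ 1 := by
    intro h
    have h0 := hli.ne_zero 0
    simp [h] at h0
  -- Step 2: shear, in two cases.
  have h2 : (2 : Cardinal) ≤ Algebra.trdeg ℚ
      ↥(adjoin ℚ (Set.range ![((Real.log q₁ : ℝ) : ℂ), ((Real.log q₂ : ℝ) : ℂ)])) := by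
    rcases eq_or_ne m₁ 0 with hm₁ | hm₁
    · -- `log q₁` is fixed and `log q₂` is sheared along `2πi m₂`
      have hm₂ : m₂ ≠ 0 := hm.resolve_left (fun h => h hm₁)
      have hfix : ρ ((Real.log q₁ : ℝ) : ℂ) = ((Real.log q₁ : ℝ) : ℂ) := by
        rw [hρ₁, hm₁]
        simp
      have hAI : AlgebraicIndependent ℚ ![((Real.log q₂ : ℝ) : ℂ), ((Real.log q₁ : ℝ) : ℂ)] :=
        algebraicIndependent_of_shear_of_transcendental ρ (a := m₂ * (2 * Real.pi * I)) hρ₂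
          (by rw [map_mul, map_intCast, hρτ]) hfix (mul_ne_zero (by exact_mod_cast hm₂) hτ0)
          (transcendental_log_ratCast hq₁ hq₁1)
      exact Literature.Barriers.Schanuel.natCast_le_trdeg_of_algebraicIndependent (k := 2) hAI
        (Fin.forall_fin_two.mpr ⟨hmem₂, hmem₁⟩)
    · -- `y = m₁ log q₂ - m₂ log q₁` is fixed and `log q₁` is sheared along `2πi m₁`
      set y : ℂ := (m₁ : ℂ) * ((Real.log q₂ : ℝ) : ℂ) - (m₂ : ℂ) * ((Real.log q₁ : ℝ) : ℂ)
        with hy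
      have hfix : ρ y = y := by
        simp only [hy, map_sub, map_mul, map_intCast, hρ₁, hρ₂]
        ring
      -- `y` is the logarithm of the rational `r = q₂ ^ m₁ / q₁ ^ m₂ ≠ 1`
      set r : ℚ := q₂ ^ m₁ / q₁ ^ m₂ with hr
      have hr0 : 0 < r := by
        rw [hr]
        positivity
      have hyr : y = ((Real.log r : ℝ) : ℂ) := by
        have hq₁' : (q₁ : ℝ) ^ m₂ ≠ 0 := zpow_ne_zero _ (by exact_mod_cast hq₁.ne')
        have hq₂' : (q₂ : ℝ) ^ m₁ ≠ 0 := zpow_ne_zero _ (by exact_mod_cast hq₂.ne')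
        rw [hy, hr]
        push_cast
        rw [Real.log_div hq₂' hq₁', Real.log_zpow, Real.log_zpow]
        push_cast
        ring
      have hy0 : y ≠ 0 := by
        intro h0
        have hrel : ((-m₂ : ℤ) : ℚ) • ((Real.log q₁ : ℝ) : ℂ) +
            ((m₁ : ℤ) : ℚ) • ((Real.log q₂ : ℝ) : ℂ) = 0 := by
          rw [Rat.smul_def, Rat.smul_def]
          push_cast
          rw [← h0, hy]
          ring
        have := (LinearIndependent.pair_iff.mp hli _ _ hrel).2
        exact hm₁ (by exact_mod_cast this)
      have hr1 : r ≠ 1 := by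
        intro h1
        apply hy0
        rw [hyr, h1]
        simp
      have hyt : Transcendental ℚ y := by
        rw [hyr]
        exact transcendental_log_ratCast hr0 hr1
      have hAI : AlgebraicIndependent ℚ ![((Real.log q₁ : ℝ) : ℂ), y] :=
        algebraicIndependent_of_shear_of_transcendental ρ (a := m₁ * (2 * Real.pi * I)) hρ₁
          (by rw [map_mul, map_intCast, hρτ]) hfix (mul_ne_zero (by exact_mod_cast hm₁) hτ0) hyt
      refine Literature.Barriers.Schanuel.natCast_le_trdeg_of_algebraicIndependent (k := 2) hAI
        (Fin.forall_fin_two.mpr ⟨hmem₁, ?_⟩)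
      change y ∈ _
      rw [hy]
      exact sub_mem (mul_mem (intCast_mem _ m₁) hmem₂) (mul_mem (intCast_mem _ m₂) hmem₁)
  exact Literature.Barriers.Schanuel.algebraicIndependent_of_le_trdeg_adjoin _ h2

/-! ### 3. The emblematic pair `(log 2, log 3)` and the headline -/

/-- `log 2, log 3` are `ℚ`-linearly independent (unique factorisation; tree). -/
private theorem linearIndependent_log_two_log_three' :
    LinearIndependent ℚ ![((Real.log 2 : ℝ) : ℂ), ((Real.log 3 : ℝ) : ℂ)] := by
  have h := Nat.linearIndependent_log_of_prime_ne Nat.prime_two Nat.prime_three (by norm_num)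
  simpa using h

/-- **SC(2) at `(log 2, log 3)`** IF some endomorphism of `ℂ_exp` moves `log 2` or `log 3`:
`log 2 ⟂ log 3` and the transcendence-degree inequality of the summit's format. [this file] -/
theorem schanuel_pair_log_two_log_three_of_expEnd_moves
    (h : ∃ σ : ℂ →+* ℂ, (∀ z, σ (cexp z) = cexp (σ z)) ∧
      (σ ((Real.log 2 : ℝ) : ℂ) ≠ ((Real.log 2 : ℝ) : ℂ) ∨
        σ ((Real.log 3 : ℝ) : ℂ) ≠ ((Real.log 3 : ℝ) : ℂ))) :
    AlgebraicIndependent ℚ ![((Real.log 2 : ℝ) : ℂ), ((Real.log 3 : ℝ) : ℂ)] ∧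
      (2 : Cardinal) ≤ Algebra.trdeg ℚ
        ↥(expField ![((Real.log 2 : ℝ) : ℂ), ((Real.log 3 : ℝ) : ℂ)]) := by
  obtain ⟨σ, hσ, hmove⟩ := h
  have hAI : AlgebraicIndependent ℚ ![((Real.log 2 : ℝ) : ℂ), ((Real.log 3 : ℝ) : ℂ)] := by
    have h := algebraicIndependent_log_log_of_expEnd σ hσ (q₁ := 2) (q₂ := 3) (by norm_num)
      (by norm_num) (by simpa using linearIndependent_log_two_log_three') (by simpa using hmove)
    simpa using h
  refine ⟨hAI, le_trdeg_expField_of_algebraicIndependent (n := 2) hAI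
    (Fin.forall_fin_two.mpr ⟨?_, ?_⟩)⟩
  · simpa using self_mem_expField ![((Real.log 2 : ℝ) : ℂ), ((Real.log 3 : ℝ) : ℂ)] 0
  · simpa using self_mem_expField ![((Real.log 2 : ℝ) : ℂ), ((Real.log 3 : ℝ) : ℂ)] 1

/-- **Headline (Theorem O, three pairs).** If ONE endomorphism of `ℂ_exp` moves `log 2`, then
Schanuel's conjecture holds at three of the six emblematic open pairs: `(iπ, log 2)`,
`(1, log 2)` and `(log 2, log 3)` — in the summit's format
`2 ≤ trdeg_ℚ ℚ(z₁, z₂, e^{z₁}, e^{z₂})`. [this file] -/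
theorem schanuel_three_pairs_of_expEnd_moves_log_two
    (h : ∃ σ : ℂ →+* ℂ, (∀ z, σ (cexp z) = cexp (σ z)) ∧
      σ ((Real.log 2 : ℝ) : ℂ) ≠ ((Real.log 2 : ℝ) : ℂ)) :
    (2 : Cardinal) ≤ Algebra.trdeg ℚ ↥(expField ![(Real.pi : ℂ) * I, ((Real.log 2 : ℝ) : ℂ)]) ∧
      (2 : Cardinal) ≤ Algebra.trdeg ℚ ↥(expField ![(1 : ℂ), ((Real.log 2 : ℝ) : ℂ)]) ∧
      (2 : Cardinal) ≤ Algebra.trdeg ℚ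
        ↥(expField ![((Real.log 2 : ℝ) : ℂ), ((Real.log 3 : ℝ) : ℂ)]) := by
  obtain ⟨σ, hσ, hmove⟩ := h
  have h1 := schanuel_pairs_log_two_of_expEnd_moves ⟨σ, hσ, hmove⟩
  have h2 := schanuel_pair_log_two_log_three_of_expEnd_moves ⟨σ, hσ, Or.inl hmove⟩
  exact ⟨h1.2.2.1, h1.2.2.2, h2.2⟩

end Summit.Schanuel.Schanuel.Theorems
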